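import Summits.NavierStokesRegularity.NavierStokesRegularity.Theorems.SoloSalvageWu2026RadialTests
import Summits.NavierStokesRegularity.NavierStokesRegularity.Theorems.SoloSalvageWu2026Renormalisation
import Mathlib.Analysis.SpecialFunctions.Pow.Asymptotics
import HarnessLib

/-!
# C177 `Wu2026` — TRUE column, Prop 3.4 (part 4/4): `Step_P34` HOLDS

D-0090 NS-CLAIMS sweep, claim C177 (W. Wu, arXiv:2608.22471v1), skeleton
`Literature/Claims/NS/Wu2026.lean` (typist-10 g6; rev 2 p560520); TRUE-column kernel objects for the
consumed binder `hP34` of `claim_of_steps''` — Proposition 3.4 p.22 l.3–8 (proof p.22 l.9 – p.23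
l.46) «For every τ > 0, F_τ = 0. (3.66) Moreover, ∫_{S_r} QV·n dS = 0 for almost every r > 0.
(3.67)», typed as `Step_P34` (companion laws `div(β(Q)V) = 0` in `D'({|y| > 1})` for all
`β ∈ C¹` with `β'` bounded ⟹ `ZeroRadialFlux (Ioi 1) T.V T.Q`). Records, not a verdict (row #164
lettered «discharges», RULINGS v1.51/v1.54); salvage-p1 g5 (DECONFLICT 20:19Z).

Proof (the printed route, kernel version; parts 1–3 supply the tools). For the functional
`Λ_β(η) = ∫ η(|y|) β(Q) V·y/|y|`: the companion law with `β = Ψ_τ` gives `Λ(h') = 0` for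
`h ∈ C_c^∞((1,∞))` (part 1); writing `η = h_R' + (∫η)g_R` (part 1) yields
`Λ(η) = (∫η)Λ(g_R)` with `|Λ(g_R)| ≤ (2K/R)∫_{A_R}|Ψ_τ(Q)||V| ≤ 2Kcτ^{−1/16}R^{−1/6} → 0` (part 3),
so `Λ_{Ψ_τ}(η) = 0` for every `τ > 0` — (3.66), `Tangent.renormalised_flux_eq_zero`; then
`τ = 1/(n+1) → 0⁺` by dominated convergence (`Ψ_τ(Q) → Q`, `|Ψ_τ(Q)| ≤ |Q|`, dominating function
`|η(|y|)||Q||V| ∈ L¹` from part 2) gives `ZeroRadialFlux (Ioi 1) T.V T.Q` — `step_P34`.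

WHAT THIS IS NOT: not a claim about NS regularity or blow-up; not a claim about any author beyond
the typed locator.
-/

noncomputable section

set_option linter.dupNamespace false

open MeasureTheory Set Function Filter Topology Metric
open scoped ENNReal NNReal RealInnerProductSpace Topology

namespace Summit.NavierStokesRegularity.NavierStokesRegularity.Theorems.Wu2026Salvage

open Literature.Analysis.FluidPDE Literature.Analysis.FunctionSpaces Literature.Claims.NS.Wu2026

/-! ### The renormalised fluxes vanish ((3.66)) and `τ → 0⁺` ((3.67)): `Step_P34` -/

section Main

variable {ν : ℝ} {v : E3 → E3} {p : E3 → ℝ}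

/-- **(3.66): the renormalised radial fluxes vanish.** If the companion law holds for `β = Ψ_τ`,
then `∫ η(|y|) Ψ_τ(Q) V·y/|y| dy = 0` for every `η ∈ C_c^∞((1,∞))` (decomposition
`η = h_R' + (∫η)g_R`, `Λ(h_R') = 0` by the companion law, and `|Λ(g_R)| ≤ (2K/R)∫_{A_R}|Ψ_τ(Q)||V|
= O(R^{−1/6}) → 0`). [cite: Wu2026, Prop 3.4 (3.66) p.22 l.3–46] -/
theorem Tangent.renormalised_flux_eq_zero (T : Tangent ν v p) {τ : ℝ} (hτ : 0 < τ)
    (hlaw : WeakDivFreeOn exterior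
      (fun y => (T.Q y * (1 - Real.exp (-(T.Q y) ^ 2 / τ))) • T.V y))
    {η : ℝ → ℝ} (hη : IsTestRad (Ioi 1) η) :
    ∫ y : E3, η ‖y‖ * ((T.Q y * (1 - Real.exp (-(T.Q y) ^ 2 / τ))) * ⟪T.V y, y⟫ / ‖y‖) = 0 := by
  set Ψ : ℝ → ℝ := fun z => z * (1 - Real.exp (-z ^ 2 / τ)) with hΨ
  have hΨc : Continuous Ψ := (psiTau_contDiff_and_deriv_bound hτ).1.continuous
  have hΨle : ∀ z, |Ψ z| ≤ |z| := abs_psiTau_le_abs hτ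
  -- the flux density and the functional `Λ`
  set Kf : E3 → ℝ := fun y => Ψ (T.Q y) * ⟪T.V y, y⟫ / ‖y‖ with hKf
  have hKm : AEStronglyMeasurable Kf volume := Tangent.aestronglyMeasurable_flux T hΨc
  have hKle : ∀ y, |Kf y| ≤ |T.Q y| * ‖T.V y‖ := fun y => abs_flux_le hΨle _ _ _
  have hKle' : ∀ y, |Kf y| ≤ |Ψ (T.Q y)| * ‖T.V y‖ := fun y =>
    abs_flux_le (β := id) (fun z => le_rfl) (Ψ (T.Q y)) (T.V y) y
  change ∫ y : E3, η ‖y‖ * Kf y = 0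
  set Λ : ℝ := ∫ y : E3, η ‖y‖ * Kf y with hΛ
  -- constants
  obtain ⟨K, hK0, hKb, hKneg, hKpos⟩ := exists_deriv_smoothTransition_bound
  obtain ⟨c, hc0, hc⟩ := Tangent.lintegral_annulus_psiTau_le T
  obtain ⟨hVm, -, -⟩ := T.locInt
  have hQm := Tangent.aestronglyMeasurable_Q T
  set m : ℝ := ∫ s, η s with hm
  -- the bound `|Λ| ≤ |m| (2K/R) τ^{-1/16} c R^{5/6}` for every `R > 1`
  have hbound : ∀ R : ℝ, 1 < R →
      |Λ| ≤ |m| * (2 * K / R * (τ ^ (-(1 : ℝ) / 16) * (c * R ^ ((5 : ℝ) / 6)))) := by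
    intro R hR
    have hR0 : 0 < R := lt_trans zero_lt_one hR
    obtain ⟨h, g, hh, hgc, hdec, hgb, hgs⟩ := exists_radial_decomposition hη hKb hKneg hKpos hR
    obtain ⟨a₁, b₁, ha₁, ha₁', hb₁'⟩ := exists_bounds_of_isTestRad hh
    -- integrability of the densities `h'(|y|) Kf` and `g(|y|) Kf`
    have hId : Integrable (fun y : E3 => deriv h ‖y‖ * Kf y) := by
      refine Tangent.integrable_radial_mul T (hh.1.continuous_deriv (by simp)) (lt_trans zero_lt_one ha₁)
        (b := b₁) (fun r hr => ?_) hKm hKle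
      rw [mem_Icc, not_and_or, not_le, not_le] at hr
      rcases hr with hr | hr
      · have hev : h =ᶠ[𝓝 r] fun _ => (0 : ℝ) := by
          filter_upwards [Iio_mem_nhds hr] with s hs using ha₁' s hs
        rw [hev.deriv_eq]; exact deriv_const r 0
      · have hev : h =ᶠ[𝓝 r] fun _ => (0 : ℝ) := by
          filter_upwards [Ioi_mem_nhds hr] with s hs using hb₁' s hs
        rw [hev.deriv_eq]; exact deriv_const r 0
    have hIg : Integrable (fun y : E3 => g ‖y‖ * Kf y) := by
      refine Tangent.integrable_radial_mul T hgc hR0 (b := 2 * R) (fun r hr => ?_) hKm hKle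
      by_contra hne
      exact hr ⟨(hgs r hne).1.le, (hgs r hne).2.le⟩
    -- `Λ = m Λ(g)`
    have hsplit : Λ = m * ∫ y : E3, g ‖y‖ * Kf y := by
      have h1 : (fun y : E3 => η ‖y‖ * Kf y) = fun y => deriv h ‖y‖ * Kf y + m * (g ‖y‖ * Kf y) := by
        funext y; rw [hdec ‖y‖]; ring
      rw [hΛ, h1, integral_add hId (hIg.const_mul m), integral_const_mul]
      have h0 : ∫ y : E3, deriv h ‖y‖ * Kf y = 0 := by
        have h2 := flux_deriv_eq_zero (V := T.V) (Q := T.Q) (β := Ψ) hlaw hh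
        have h3 : (fun y : E3 => deriv h ‖y‖ * Kf y) =
            fun y => deriv h ‖y‖ * ((T.Q y * (1 - Real.exp (-(T.Q y) ^ 2 / τ))) * ⟪T.V y, y⟫ / ‖y‖) := by
          funext y; rfl
        rw [h3]; exact h2
      rw [h0, zero_add]
    -- `|Λ(g)| ≤ (2K/R) ∫_{A_R} |Ψ(Q)||V| ≤ (2K/R) τ^{-1/16} c R^{5/6}`
    set J : ℝ≥0∞ := ∫⁻ y in annulus R, ENNReal.ofReal (|Ψ (T.Q y)| * ‖T.V y‖) with hJ
    have hJle : J ≤ ENNReal.ofReal (τ ^ (-(1 : ℝ) / 16) * (c * R ^ ((5 : ℝ) / 6))) := hc τ hτ R hR0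
    have hJfin : J < ∞ := hJle.trans_lt ENNReal.ofReal_lt_top
    have hAm : AEStronglyMeasurable (fun y : E3 => |Ψ (T.Q y)| * ‖T.V y‖) volume :=
      (continuous_abs.comp_aestronglyMeasurable (hΨc.comp_aestronglyMeasurable hQm)).mul hVm.norm
    have hAi : IntegrableOn (fun y : E3 => |Ψ (T.Q y)| * ‖T.V y‖) (annulus R) := by
      refine ⟨hAm.restrict, ?_⟩
      rw [hasFiniteIntegral_iff_ofReal (ae_of_all _ fun y => by positivity)]
      exact hJfin
    have hGi : Integrable (fun y : E3 => 2 * K / R *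
        (annulus R).indicator (fun y => |Ψ (T.Q y)| * ‖T.V y‖) y) :=
      (hAi.integrable_indicator (measurableSet_dyadicAnnulus R)).const_mul _
    have hKR : 0 ≤ 2 * K / R := by positivity
    have hgK : ‖∫ y : E3, g ‖y‖ * Kf y‖ ≤
        ∫ y : E3, 2 * K / R * (annulus R).indicator (fun y => |Ψ (T.Q y)| * ‖T.V y‖) y := by
      refine norm_integral_le_of_norm_le hGi (ae_of_all _ fun y => ?_)
      rw [Real.norm_eq_abs, abs_mul]
      by_cases hgy : g ‖y‖ = 0
      · rw [hgy, abs_zero, zero_mul]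
        exact mul_nonneg hKR (Set.indicator_nonneg (fun z _ => by positivity) y)
      · have hyA : y ∈ annulus R := hgs _ hgy
        rw [indicator_of_mem hyA]
        exact mul_le_mul (hgb _) (hKle' y) (abs_nonneg _) hKR
    have hJreal : ∫ y : E3, 2 * K / R * (annulus R).indicator (fun y => |Ψ (T.Q y)| * ‖T.V y‖) y ≤
        2 * K / R * (τ ^ (-(1 : ℝ) / 16) * (c * R ^ ((5 : ℝ) / 6))) := by
      rw [integral_const_mul, integral_indicator (measurableSet_dyadicAnnulus R)]
      refine mul_le_mul_of_nonneg_left ?_ hKR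
      rw [integral_eq_lintegral_of_nonneg_ae (ae_of_all _ fun y => by positivity) hAm.restrict]
      exact ENNReal.toReal_le_of_le_ofReal (by positivity) hJle
    calc |Λ| = |m| * |∫ y : E3, g ‖y‖ * Kf y| := by rw [hsplit, abs_mul]
      _ ≤ |m| * (2 * K / R * (τ ^ (-(1 : ℝ) / 16) * (c * R ^ ((5 : ℝ) / 6)))) := by
          refine mul_le_mul_of_nonneg_left ?_ (abs_nonneg _)
          rw [← Real.norm_eq_abs]
          exact hgK.trans hJreal
  -- the bound tends to `0` as `R → ∞`
  have hlim : Tendsto (fun R : ℝ => |m| * (2 * K / R * (τ ^ (-(1 : ℝ) / 16) * (c * R ^ ((5 : ℝ) / 6)))))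
      atTop (𝓝 0) := by
    have h1 : Tendsto (fun R : ℝ => R ^ (-((1 : ℝ) / 6))) atTop (𝓝 0) :=
      tendsto_rpow_neg_atTop (by norm_num)
    have h2 := h1.const_mul (|m| * (2 * K * (τ ^ (-(1 : ℝ) / 16) * c)))
    rw [mul_zero] at h2
    refine h2.congr' ?_
    filter_upwards [eventually_gt_atTop (0 : ℝ)] with R hR
    have e : R ^ ((5 : ℝ) / 6) / R = R ^ (-((1 : ℝ) / 6)) := by
      rw [show -((1 : ℝ) / 6) = (5 : ℝ) / 6 - 1 by norm_num, Real.rpow_sub hR, Real.rpow_one]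
    rw [← e]
    field_simp
  -- hence `|Λ| ≤ 0`
  have hle : |Λ| ≤ 0 :=
    ge_of_tendsto hlim (by
      filter_upwards [eventually_gt_atTop (1 : ℝ)] with R hR using hbound R hR)
  exact abs_nonpos_iff.1 hle

/-- **`Step_P34` HOLDS (Proposition 3.4 (3.66)–(3.67), typed on `r > 1`).** From the companion laws
with `β = Ψ_τ`, `τ = 1/(n+1)`, every renormalised radial flux functional vanishes
(`Tangent.renormalised_flux_eq_zero`); letting `τ → 0⁺` by dominated convergence (`Ψ_τ(Q) → Q`,
`|Ψ_τ(Q)| ≤ |Q|`, `|Q||V||η(|y|)| ∈ L¹`) gives `ZeroRadialFlux (Ioi 1) T.V T.Q`. [cite: Wu2026, Prop 3.4 p.22 l.3–8 (proof p.22 l.9 – p.23 l.46)] -/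
theorem step_P34 : Step_P34 := by
  intro ν _hν v p _hf _hD T hcomp η hη
  obtain ⟨a, b, ha1, ha, hb⟩ := exists_bounds_of_isTestRad hη
  have hηc : Continuous η := hη.1.continuous
  have ha0 : 0 < a := lt_trans zero_lt_one ha1
  have hηzero : ∀ r, r ∉ Icc a b → η r = 0 := by
    intro r hr
    rw [mem_Icc, not_and_or, not_le, not_le] at hr
    rcases hr with hr | hr
    · exact ha r hr
    · exact hb r hr
  -- the renormalised fluxes vanish for `τ_n = 1/(n+1)`
  have hτ : ∀ n : ℕ, (0 : ℝ) < 1 / ((n : ℝ) + 1) := fun n => by positivity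
  have hflux : ∀ n : ℕ,
      ∫ y : E3, η ‖y‖ * ((T.Q y * (1 - Real.exp (-(T.Q y) ^ 2 / (1 / ((n : ℝ) + 1))))) *
        ⟪T.V y, y⟫ / ‖y‖) = 0 := by
    intro n
    obtain ⟨hC, hL⟩ := psiTau_contDiff_and_deriv_bound (hτ n)
    exact Tangent.renormalised_flux_eq_zero T (hτ n) (hcomp _ hC hL) hη
  -- dominated convergence as `n → ∞`
  have hQm := Tangent.aestronglyMeasurable_Q T
  obtain ⟨hVm, -, -⟩ := T.locInt
  have hGi : Integrable (fun y : E3 => |η ‖y‖| * (|T.Q y| * ‖T.V y‖)) := by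
    refine Tangent.integrable_radial_mul T (f := fun r => |η r|) (continuous_abs.comp hηc) ha0
      (b := b) (fun r hr => by simp [hηzero r hr]) ?_ (fun y => ?_)
    · exact (continuous_abs.comp_aestronglyMeasurable hQm).mul hVm.norm
    · rw [abs_mul, abs_abs, abs_norm]
  have hlim := tendsto_integral_of_dominated_convergence (fun y : E3 => |η ‖y‖| * (|T.Q y| * ‖T.V y‖))
    (F := fun (n : ℕ) (y : E3) => η ‖y‖ * ((T.Q y * (1 - Real.exp (-(T.Q y) ^ 2 / (1 / ((n : ℝ) + 1))))) *
      ⟪T.V y, y⟫ / ‖y‖))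
    (f := fun y : E3 => η ‖y‖ * (T.Q y * ⟪T.V y, y⟫ / ‖y‖)) (fun n => ?_) hGi (fun n => ae_of_all _ fun y => ?_)
    (ae_of_all _ fun y => ?_)
  · -- the limit of the zero sequence is zero
    have h0 : (fun n : ℕ => ∫ y : E3, η ‖y‖ * ((T.Q y * (1 - Real.exp (-(T.Q y) ^ 2 / (1 / ((n : ℝ) + 1))))) *
        ⟪T.V y, y⟫ / ‖y‖)) = fun _ => 0 := funext hflux
    rw [h0] at hlim
    exact tendsto_nhds_unique hlim tendsto_const_nhds
  · -- measurability
    exact (hηc.comp continuous_norm).aestronglyMeasurable.mul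
      (Tangent.aestronglyMeasurable_flux T (psiTau_contDiff_and_deriv_bound (hτ n)).1.continuous)
  · -- domination `|η Ψ_τ(Q) V·y/|y|| ≤ |η| |Q||V|`
    rw [Real.norm_eq_abs, abs_mul]
    exact mul_le_mul_of_nonneg_left (abs_flux_le (abs_psiTau_le_abs (hτ n)) _ _ _) (abs_nonneg _)
  · -- pointwise convergence `Ψ_τ(Q(y)) → Q(y)`
    exact ((tendsto_psiTau (T.Q y)).mul_const _ |>.div_const _ |>.const_mul _)

end Main
end Summit.NavierStokesRegularity.NavierStokesRegularity.Theorems.Wu2026Salvage
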